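import Literature.AlgebraicGeometry.Resolution.QuasiExcellentSchemes
import Mathlib.AlgebraicGeometry.Morphisms.FiniteType
import HarnessLib

/-!
# The regular locus of a scheme locally of finite type over a quasi-excellent scheme is open

Topic: `Literature/AlgebraicGeometry/Resolution`. A step in the decomposition of the named fact
`Temkin2008_prop234` (`Temkin2008Localization.lean`, Temkin 2008 Prop. 2.3.4: localization of
desingularization): the Noetherian induction in Temkin's proof uses at every stage that the
singular locus `X_sing = X ∖ Reg X` of a scheme of finite type over the Noetherian
quasi-excellent base `k` is closed ("By properness of `f''`, the set `R = f''(X''_sing)` is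
closed", proof of Prop. 2.3.4, arXiv p. 12). This is the J-2 property of quasi-excellent rings
(Matsumura §32, p. 260, condition (3): `Reg(B)` is open for every finitely generated
`A`-algebra `B`), globalised.

## Content (namespace `Literature.AlgGeom`), all PROVED [folklore]

* `mem_regularLocus_fromSpec_iff`, `fromSpec_preimage_regularLocus` — for an affine open `U ⊆ X` and `y ∈ Spec Γ(X, U)`, the point
  `hU.fromSpec y` is regular iff `y ∈ Reg Γ(X, U)` (the stalk is the localization at `y`).
* `isOpen_regularLocus_inter_of_isAffineOpen` — if `Reg Γ(X, U)` is open in `Spec Γ(X, U)` then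
  `Reg X ∩ U` is open in `X`.
* `isOpen_regularLocus_of_locallyOfFiniteType` — **for `f : X ⟶ k` locally of finite type with `k`
  quasi-excellent (`Scheme.IsQuasiExcellent`), `Reg X` is open** (EGA IV₂ 7.8.3 (iv) / 7.8.6;
  Matsumura §32).

## Sources

* H. Matsumura, *Commutative Ring Theory*, CUP 1986, §32 (p. 260, Definition: quasi-excellent
  rings, condition (3) = J-2). [Matsumura1987]
* M. Temkin, *Desingularization of quasi-excellent schemes in characteristic zero*, Adv. Math.
  219 (2008), proof of Prop. 2.3.4 (arXiv:math/0703678, p. 12). [Temkin2008]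
-/

noncomputable section

open CategoryTheory AlgebraicGeometry TopologicalSpace

namespace Literature.AlgebraicGeometry.Resolution

universe u

/-- For an affine open `U ⊆ X` and a prime `y` of `Γ(X, U)`, the point `hU.fromSpec y ∈ X` is a
regular point iff `y` lies in the regular locus of the ring `Γ(X, U)`: the stalk `𝒪_{X, y}` is
the localization `Γ(X, U)_y`. [folklore] -/
theorem mem_regularLocus_fromSpec_iff {X : Scheme.{u}} {U : X.Opens} (hU : IsAffineOpen U)
    (y : PrimeSpectrum Γ(X, U)) :
    hU.fromSpec y ∈ Scheme.regularLocus X ↔ y ∈ regularLocus Γ(X, U) := by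
  have hy : hU.fromSpec y ∈ U := hU.range_fromSpec.le ⟨y, rfl⟩
  letI : Algebra Γ(X, U) (X.presheaf.stalk (hU.fromSpec y)) :=
    TopCat.Presheaf.algebra_section_stalk X.presheaf ⟨hU.fromSpec y, hy⟩
  have hloc : IsLocalization.AtPrime (X.presheaf.stalk (hU.fromSpec y)) y.asIdeal :=
    hU.isLocalization_stalk' y hy
  let e : X.presheaf.stalk (hU.fromSpec y) ≃+* Localization.AtPrime y.asIdeal :=
    (IsLocalization.algEquiv y.asIdeal.primeCompl (X.presheaf.stalk (hU.fromSpec y))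
      (Localization.AtPrime y.asIdeal)).toRingEquiv
  rw [Scheme.mem_regularLocus, mem_regularLocus]
  exact ⟨fun h => IsRegularLocalRing.of_ringEquiv e, fun h => IsRegularLocalRing.of_ringEquiv e.symm⟩

/-- The preimage of the regular locus of `X` under `Spec Γ(X, U) ⟶ X` (an affine open `U`) is the
regular locus of the ring `Γ(X, U)`. [folklore] -/
theorem fromSpec_preimage_regularLocus {X : Scheme.{u}} {U : X.Opens}
    (hU : IsAffineOpen U) :
    hU.fromSpec ⁻¹' Scheme.regularLocus X = regularLocus Γ(X, U) := by
  ext y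
  exact mem_regularLocus_fromSpec_iff hU y

/-- If the regular locus of the coordinate ring of an affine open `U ⊆ X` is open in
`Spec Γ(X, U)`, then `Reg X ∩ U` is open in `X`. [folklore] -/
theorem isOpen_regularLocus_inter_of_isAffineOpen {X : Scheme.{u}} {U : X.Opens}
    (hU : IsAffineOpen U) (h : IsOpen (regularLocus Γ(X, U))) :
    IsOpen (Scheme.regularLocus X ∩ (U : Set X)) := by
  have : Scheme.regularLocus X ∩ (U : Set X) = hU.fromSpec '' regularLocus Γ(X, U) := by
    rw [← fromSpec_preimage_regularLocus hU, Set.image_preimage_eq_inter_range, hU.range_fromSpec]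
  rw [this]
  exact hU.fromSpec.isOpenEmbedding.isOpenMap _ h

/-- **The regular locus of a scheme locally of finite type over a quasi-excellent scheme is
open** (the J-2 condition in the definition of quasi-excellence, Matsumura §32 p. 260 (3),
applied to the coordinate rings of small affine opens, which are of finite type over affine
opens of the base). [cite: Matsumura1987, §32 p. 260 Definition] -/
theorem isOpen_regularLocus_of_locallyOfFiniteType {X k : Scheme.{u}} (f : X ⟶ k)
    [LocallyOfFiniteType f] (hk : Scheme.IsQuasiExcellent k) :
    IsOpen (Scheme.regularLocus X) := by
  rw [isOpen_iff_forall_mem_open]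
  intro x hx
  obtain ⟨U, hU, hfxU, -⟩ :=
    exists_isAffineOpen_mem_and_subset (X := k) (x := f x) (U := ⊤) trivial
  obtain ⟨V, hV, hxV, hVU⟩ :=
    exists_isAffineOpen_mem_and_subset (X := X) (x := x) (U := f ⁻¹ᵁ U) hfxU
  have hft : RingHom.FiniteType (f.appLE U V hVU).hom :=
    HasRingHomProperty.appLE @LocallyOfFiniteType f ‹_› ⟨U, hU⟩ ⟨V, hV⟩ hVU
  have hopen : IsOpen (regularLocus Γ(X, V)) := by
    letI : Algebra Γ(k, U) Γ(X, V) := (f.appLE U V hVU).hom.toAlgebra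
    haveI : Algebra.FiniteType Γ(k, U) Γ(X, V) := hft
    exact (hk ⟨U, hU⟩).isJ2Ring.2 Γ(X, V) ‹_›
  exact ⟨Scheme.regularLocus X ∩ (V : Set X), Set.inter_subset_left,
    isOpen_regularLocus_inter_of_isAffineOpen hV hopen, hx, hxV⟩

/-- The singular locus `X ∖ Reg X` of a scheme locally of finite type over a quasi-excellent
scheme is closed. [cite: Matsumura1987, §32 p. 260 Definition] -/
theorem isClosed_compl_regularLocus_of_locallyOfFiniteType {X k : Scheme.{u}} (f : X ⟶ k)
    [LocallyOfFiniteType f] (hk : Scheme.IsQuasiExcellent k) :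
    IsClosed (Scheme.regularLocus X)ᶜ :=
  (isOpen_regularLocus_of_locallyOfFiniteType f hk).isClosed_compl

end Literature.AlgebraicGeometry.Resolution

end
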